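import Literature.AlgebraicGeometry.HodgeTheory.GAGADimensionAlgebra
import HarnessLib

/-!
# GAGA dimension comparison — simple points of a subvariety (algebraic half)

Second proof file for the named fact
`Literature.AlgebraicGeometry.HodgeTheory.gaga_le_coheight_of_regularLocus_codim`
(`HodgeTheory/GAGADimension.lean`; Serre, *GAGA* §6 Prop. 3 Cor. 2–3, p. 11), continuing
`GAGADimensionAlgebra.lean`. For a domain `A`, standard smooth of relative dimension `n` over an
algebraically closed field `K`, and a prime `𝔭 ⊂ A` of height `c`, `exists_simplePointData`
produces the commutative algebra of a *simple point* of `V(𝔭)` in Serre's sense (GAGA §1 n°4,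
§2 n°6 Cor. 2): `c` elements `g₁, …, g_c ∈ 𝔭` generating `𝔭` off a hypersurface `V(h)`, a
`K`-rational maximal ideal `𝔪 ⊇ 𝔭` off `V(h h₀)` at which the `gⱼ` are linearly independent
modulo `𝔪²`, and local coordinates `t₁, …, tₙ` of `A` at `𝔪` modulo `𝔪²`. Ingredients:

* `maximalIdeal_le_span_of_quotient` — generators of `𝔪 A_𝔪` from a regular point of `A/𝔭`;
* `exists_minimalPrime_forall_iff` — isolating one minimal prime (irreducible component) of an
  ideal off a hypersurface;
* from `GAGADimensionAlgebra.lean`: generators of a prime from its regular localisation, generic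
  smoothness of affine domains over a perfect field (Mathlib `Algebra.FormallySmooth.of_perfectField`,
  `Algebra.isOpen_smoothLocus`, `Algebra.IsSmoothAt.exists_notMem_isStandardSmooth`; the tree's
  `Motives.isRegularLocalRing_of_isStandardSmoothOfRelativeDimension`), the Nakayama rank drop and
  the independence / local-coordinate lemmas;
* from the tree: the affine dimension formula `height 𝔭 + dim A/𝔭 = dim A`
  (`Motives.Ideal.height_add_ringKrullDim_quotient`, `Motives.height_add_coheight_eq_of_isDomain`,
  Hartshorne I Thm. 1.8A), `dim A = n` and the height of maximal ideals of standard smooth algebras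
  (`Motives.ringKrullDim_eq_of_isStandardSmoothOfRelativeDimension`,
  `Motives.height_eq_of_isStandardSmoothOfRelativeDimension`), and Mathlib's Nullstellensatz
  (`finite_of_finite_type_of_isJacobsonRing`, `IsAlgClosed.algebraMap_bijective_of_isIntegral`).

## References

* J.-P. Serre, *Géométrie algébrique et géométrie analytique*, Ann. Inst. Fourier **6** (1956),
  §1 n°4, §2 n°6 Prop. 3 Cor. 2–3 (p. 11). [SerreGAGA1956]
* U. Görtz, T. Wedhorn, *Algebraic Geometry I*, 2nd ed. (2020), Thm. 6.19, Lemma 6.26.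
  [GortzWedhorn2020]
* R. Hartshorne, *Algebraic Geometry* (1977), I Thm. 1.8A, I Thm. 5.3. [Hartshorne1977]
-/

noncomputable section

open IsLocalRing

universe u

namespace Literature.AlgebraicGeometry.HodgeTheory

namespace GAGADimension

/-! ### Generators of `𝔪 A_𝔪` from a regular point of `A/𝔭` -/

section Quotient

variable {A : Type*} [CommRing A] [IsNoetherianRing A]

/-- Let `𝔭 ⊂ A` be prime, `𝔫 ⊂ A/𝔭` maximal with `(A/𝔭)_𝔫` regular of dimension `d`, and
`𝔪 = 𝔫 ∩ A`. If `h · 𝔭 ⊆ (g₁, …, g_c)` with `h ∉ 𝔪`, then `𝔪 A_𝔪` is spanned by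
`g₁, …, g_c, s₁, …, s_d` for suitable lifts `sᵢ ∈ 𝔪` of generators of `𝔫 (A/𝔭)_𝔫`. [folklore] -/
theorem maximalIdeal_le_span_of_quotient (𝔭 : Ideal A) [𝔭.IsPrime] (𝔫 : Ideal (A ⧸ 𝔭))
    [𝔫.IsMaximal] [IsRegularLocalRing (Localization.AtPrime 𝔫)] {c d : ℕ}
    (hdim : ringKrullDim (Localization.AtPrime 𝔫) = d) (g : Fin c → A) (h : A)
    (hh : h ∉ 𝔫.comap (Ideal.Quotient.mk 𝔭))
    (hg : ∀ a ∈ 𝔭, h * a ∈ Ideal.span (Set.range g)) :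
    ∃ s : Fin d → A, (∀ i, s i ∈ 𝔫.comap (Ideal.Quotient.mk 𝔭)) ∧
      maximalIdeal (Localization.AtPrime (𝔫.comap (Ideal.Quotient.mk 𝔭))) ≤
        Ideal.span (Set.range (algebraMap A _ ∘ g) ∪ Set.range (algebraMap A _ ∘ s)) := by
  classical
  obtain ⟨tbar, htbar, ubar, hubar, hut⟩ := exists_mul_mem_span_of_isRegularLocalRing 𝔫 hdim
  choose s hs using fun i => Ideal.Quotient.mk_surjective (tbar i)
  obtain ⟨u, rfl⟩ := Ideal.Quotient.mk_surjective ubar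
  refine ⟨s, fun i => ?_, ?_⟩
  · change Ideal.Quotient.mk 𝔭 (s i) ∈ 𝔫
    rw [hs]
    exact htbar i
  · set 𝔪 := 𝔫.comap (Ideal.Quotient.mk 𝔭) with h𝔪
    set S := Localization.AtPrime 𝔪 with hS
    rw [← Localization.AtPrime.map_eq_maximalIdeal, Ideal.map_le_iff_le_comap]
    intro a ha
    have h1 := hut (Ideal.Quotient.mk 𝔭 a) ha
    have h2 : Ideal.span (Set.range tbar) =
        (Ideal.span (Set.range s)).map (Ideal.Quotient.mk 𝔭) := by
      rw [Ideal.map_span, ← Set.range_comp, show (Ideal.Quotient.mk 𝔭) ∘ s = tbar from funext hs]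
    rw [h2, ← map_mul] at h1
    obtain ⟨y, hy, hyeq⟩ :=
      (Ideal.mem_map_iff_of_surjective _ Ideal.Quotient.mk_surjective).1 h1
    have h3 : u * a - y ∈ 𝔭 := by
      rw [← Ideal.Quotient.eq]
      exact hyeq.symm
    have h5 : h * u * a ∈ Ideal.span (Set.range g) ⊔ Ideal.span (Set.range s) := by
      have e : h * u * a = h * (u * a - y) + h * y := by ring
      rw [e]
      exact Ideal.add_mem _ (Ideal.mem_sup_left (hg _ h3))
        (Ideal.mem_sup_right (Ideal.mul_mem_left _ _ hy))
    have h6 : algebraMap A S (h * u * a) ∈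
        Ideal.span (Set.range (algebraMap A S ∘ g) ∪ Set.range (algebraMap A S ∘ s)) := by
      have h7 := Ideal.mem_map_of_mem (algebraMap A S) h5
      rwa [Ideal.map_sup, Ideal.map_span, Ideal.map_span, ← Set.range_comp, ← Set.range_comp,
        ← Ideal.span_union] at h7
    have hu𝔪 : h * u ∉ 𝔪 := fun hmem =>
      (Ideal.IsPrime.mem_or_mem inferInstance hmem).elim hh hubar
    have hunit : IsUnit (algebraMap A S (h * u)) :=
      IsLocalization.map_units S (⟨h * u, hu𝔪⟩ : 𝔪.primeCompl)
    rw [map_mul] at h6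
    exact (Ideal.unit_mul_mem_iff_mem _ hunit).1 h6

end Quotient

/-! ### Minimal primes: isolating one irreducible component -/

section MinimalPrimes

variable {A : Type*} [CommRing A] [IsNoetherianRing A]

/-- A prime `Q ⊇ I` contains a minimal prime `𝔭` of `I`, and there is `h ∉ 𝔭` (vanishing on the
other, finitely many, minimal primes) such that a prime not containing `h` lies over `I` iff it
lies over `𝔭`: off `V(h)`, the closed set `V(I)` coincides with its component `V(𝔭)`.
[folklore] -/
theorem exists_minimalPrime_forall_iff (I Q : Ideal A) [Q.IsPrime] (hIQ : I ≤ Q) :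
    ∃ 𝔭 ∈ I.minimalPrimes, 𝔭 ≤ Q ∧ ∃ h ∉ 𝔭, ∀ Q' : Ideal A, Q'.IsPrime → h ∉ Q' →
      (I ≤ Q' ↔ 𝔭 ≤ Q') := by
  classical
  obtain ⟨𝔭, h𝔭, h𝔭Q⟩ := Ideal.exists_minimalPrimes_le hIQ
  have hfin := I.finite_minimalPrimes_of_isNoetherianRing
  have hne : ∀ p ∈ I.minimalPrimes, p ≠ 𝔭 → ∃ x ∈ p, x ∉ 𝔭 := fun p hp hpne => by
    by_contra hcon
    push Not at hcon
    exact hpne (le_antisymm hcon (h𝔭.2 ⟨hp.1.1, hp.1.2⟩ hcon))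
  choose! x hx hx𝔭 using hne
  haveI := h𝔭.1.1
  refine ⟨𝔭, h𝔭, h𝔭Q, ∏ p ∈ hfin.toFinset.erase 𝔭, x p, ?_, fun Q' hQ' hhQ' =>
    ⟨fun hIQ' => ?_, fun hle => h𝔭.1.2.trans hle⟩⟩
  · refine (prod_mem fun p hp => ?_ : (∏ p ∈ hfin.toFinset.erase 𝔭, x p) ∈ 𝔭.primeCompl)
    obtain ⟨hp1, hp2⟩ := Finset.mem_erase.1 hp
    exact hx𝔭 p (hfin.mem_toFinset.1 hp2) hp1
  · obtain ⟨p', hp', hp'Q'⟩ := Ideal.exists_minimalPrimes_le hIQ'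
    by_cases hpp : p' = 𝔭
    · exact hpp ▸ hp'Q'
    · exfalso
      apply hhQ'
      have hmem : p' ∈ hfin.toFinset.erase 𝔭 :=
        Finset.mem_erase.2 ⟨hpp, hfin.mem_toFinset.2 hp'⟩
      rw [← Finset.prod_erase_mul _ _ hmem]
      exact Ideal.mul_mem_left _ _ (hp'Q' (hx p' hp' hpp))

end MinimalPrimes

/-! ### Assembly: the simple-point data attached to a prime of a smooth affine domain -/

section Assembly

/-- **Simple points of a subvariety (algebraic half of GAGA §6 Cor. 3).** Let `A` be a domain,
standard smooth of relative dimension `n` over an algebraically closed field `K`, `𝔭 ⊂ A` a prime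
of height `c` and `h₀ ∉ 𝔭`. Then there are `g₁, …, g_c ∈ 𝔭` and `h ∉ 𝔭` with `h · 𝔭 ⊆ (g)` (so
`V(𝔭) = V(g)` on `D(h)`), a `K`-rational maximal ideal `𝔪 ⊇ 𝔭` with `h, h₀ ∉ 𝔪` (a closed point of
`V(𝔭) ∩ D(h h₀)`, chosen in the smooth locus of `A/𝔭`) at which the `gⱼ` are linearly independent
modulo `𝔪²`, and local coordinates `t₁, …, tₙ ∈ 𝔪` spanning `𝔪` modulo `𝔪²` over `K`. This is the
commutative algebra behind Serre's comparison of dimensions `dim 𝒪_x = dim ℋ_x` at a simple point.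
[cite: SerreGAGA1956, §6 Prop. 3 Cor. 2–3 (p. 11) with §1 n°4]
[cite: GortzWedhorn2020, Thm. 6.19 and Lemma 6.26] -/
theorem exists_simplePointData (K : Type*) [Field K] [IsAlgClosed K] (A : Type u) [CommRing A]
    [IsDomain A] [Algebra K A] (n : ℕ) [Algebra.IsStandardSmoothOfRelativeDimension n K A]
    (𝔭 : Ideal A) [𝔭.IsPrime] (h₀ : A) (hh₀ : h₀ ∉ 𝔭) :
    ∃ (c : ℕ) (g : Fin c → A) (h : A) (𝔪 : Ideal A) (_ : 𝔪.IsMaximal) (ψ : A →ₐ[K] K)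
      (t : Fin n → A),
      (c : ℕ∞) = 𝔭.height ∧ (∀ j, g j ∈ 𝔭) ∧ (∀ a ∈ 𝔭, h * a ∈ Ideal.span (Set.range g)) ∧
      𝔭 ≤ 𝔪 ∧ h ∉ 𝔪 ∧ h₀ ∉ 𝔪 ∧ (∀ a, ψ a = 0 ↔ a ∈ 𝔪) ∧
      (∀ coef : Fin c → K, ∑ j, coef j • g j ∈ 𝔪 ^ 2 → coef = 0) ∧
      (∀ i, t i ∈ 𝔪) ∧ (∀ a ∈ 𝔪, ∃ coef : Fin n → K, a - ∑ i, coef i • t i ∈ 𝔪 ^ 2) := by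
  classical
  haveI : Algebra.IsStandardSmooth K A :=
    Algebra.IsStandardSmoothOfRelativeDimension.isStandardSmooth n
  haveI : Algebra.FiniteType K A := inferInstance
  haveI : IsNoetherianRing A := Algebra.FiniteType.isNoetherianRing K A
  have hdimA : ringKrullDim A = n :=
    Literature.AlgebraicGeometry.Motives.ringKrullDim_eq_of_isStandardSmoothOfRelativeDimension K n
  -- the height `c` of `𝔭`, and `A_𝔭` regular of dimension `c`
  obtain ⟨c, hc⟩ : ∃ c : ℕ, 𝔭.height = c := by
    obtain ⟨c, hc⟩ := ENat.ne_top_iff_exists.mp (Ideal.height_ne_top_of_isPrime (I := 𝔭))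
    exact ⟨c, hc.symm⟩
  haveI := Literature.AlgebraicGeometry.Motives.isRegularLocalRing_of_isStandardSmoothOfRelativeDimension
    K n 𝔭
  have hdim𝔭 : ringKrullDim (Localization.AtPrime 𝔭) = c := by
    rw [IsLocalization.AtPrime.ringKrullDim_eq_height 𝔭, hc]
    rfl
  obtain ⟨g, hg, h', hh', hgen⟩ := exists_mul_mem_span_of_isRegularLocalRing 𝔭 hdim𝔭
  -- `B = A/𝔭` has dimension `d` with `c + d = n`
  obtain ⟨d, hd⟩ := Literature.AlgebraicGeometry.Motives.exists_ringKrullDim_eq_natCast K (A ⧸ 𝔭)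
  have hcd : c + d = n := by
    have h1 := Literature.AlgebraicGeometry.Motives.Ideal.height_add_ringKrullDim_quotient K A 𝔭
    rw [hc, hd, hdimA] at h1
    exact_mod_cast h1
  -- a regular closed point of `Spec (A/𝔭)` off `V(h₀ h')`
  have hb : Ideal.Quotient.mk 𝔭 (h₀ * h') ≠ 0 := by
    rw [Ne, Ideal.Quotient.eq_zero_iff_mem]
    exact fun hmem => (Ideal.IsPrime.mem_or_mem inferInstance hmem).elim hh₀ hh'
  obtain ⟨𝔫, h𝔫max, hb𝔫, hreg𝔫⟩ := exists_isMaximal_isRegularLocalRing K (A ⧸ 𝔭) _ hb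
  haveI := hreg𝔫
  set 𝔪 := 𝔫.comap (Ideal.Quotient.mk 𝔭) with h𝔪def
  haveI h𝔪max : 𝔪.IsMaximal := Ideal.comap_isMaximal_of_surjective _ Ideal.Quotient.mk_surjective
  have h𝔭𝔪 : 𝔭 ≤ 𝔪 := fun a ha => by
    change Ideal.Quotient.mk 𝔭 a ∈ 𝔫
    rw [Ideal.Quotient.eq_zero_iff_mem.2 ha]
    exact zero_mem _
  have hh'𝔪 : h' ∉ 𝔪 := fun hm => hb𝔫 (by
    rw [map_mul]
    exact Ideal.mul_mem_left _ _ hm)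
  have hh₀𝔪 : h₀ ∉ 𝔪 := fun hm => hb𝔫 (by
    rw [map_mul]
    exact Ideal.mul_mem_right _ _ hm)
  -- `(A/𝔭)_𝔫` has dimension `d`
  have hdim𝔫 : ringKrullDim (Localization.AtPrime 𝔫) = d := by
    let x : PrimeSpectrum (A ⧸ 𝔭) := ⟨𝔫, h𝔫max.isPrime⟩
    have h1 := Literature.AlgebraicGeometry.Motives.height_add_coheight_eq_of_isDomain K d (A ⧸ 𝔭) hd x
    have h2 : Order.coheight x = 0 := by
      rw [Order.coheight_eq_zero]
      intro y hy
      have : y.asIdeal = 𝔫 := (h𝔫max.eq_of_le y.2.ne_top hy).symm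
      exact le_of_eq (PrimeSpectrum.ext this)
    rw [h2, add_zero] at h1
    rw [IsLocalization.AtPrime.ringKrullDim_eq_height 𝔫,
      show 𝔫 = x.asIdeal from rfl, PrimeSpectrum.height_eq_orderHeight, h1]
    rfl
  obtain ⟨s, hs, hspan⟩ := maximalIdeal_le_span_of_quotient 𝔭 𝔫 hdim𝔫 g h' hh'𝔪 hgen
  -- `A_𝔪` is regular of dimension `n = c + d`
  have hdim𝔪 : ringKrullDim (Localization.AtPrime 𝔪) = (c + d : ℕ) := by
    rw [IsLocalization.AtPrime.ringKrullDim_eq_height 𝔪,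
      Literature.AlgebraicGeometry.Motives.height_eq_of_isStandardSmoothOfRelativeDimension K n 𝔪, hcd]
    rfl
  have hindep : ∀ coef : Fin c → K, ∑ j, coef j • g j ∈ 𝔪 ^ 2 → coef = 0 := fun coef hmem =>
    eq_zero_of_sum_smul_mem_sq K 𝔪 hdim𝔪 g s (fun j => h𝔭𝔪 (hg j)) hs hspan coef hmem
  -- `𝔪` is `K`-rational (Nullstellensatz)
  letI : Field (A ⧸ 𝔪) := Ideal.Quotient.field 𝔪
  haveI : Module.Finite K (A ⧸ 𝔪) := finite_of_finite_type_of_isJacobsonRing K (A ⧸ 𝔪)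
  haveI : Algebra.IsIntegral K (A ⧸ 𝔪) := Algebra.IsIntegral.of_finite K _
  have hbij := IsAlgClosed.algebraMap_bijective_of_isIntegral (k := K) (K := A ⧸ 𝔪)
  let e : K ≃ₐ[K] (A ⧸ 𝔪) := AlgEquiv.ofBijective (Algebra.ofId K (A ⧸ 𝔪)) hbij
  let ψ : A →ₐ[K] K := (e.symm : (A ⧸ 𝔪) →ₐ[K] K).comp (Ideal.Quotient.mkₐ K 𝔪)
  have hψ : ∀ a, ψ a = 0 ↔ a ∈ 𝔪 := fun a => by
    change e.symm (Ideal.Quotient.mk 𝔪 a) = 0 ↔ a ∈ 𝔪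
    rw [map_eq_zero_iff _ e.symm.injective, Ideal.Quotient.eq_zero_iff_mem]
  -- local coordinates at `𝔪`
  haveI := Literature.AlgebraicGeometry.Motives.isRegularLocalRing_of_isStandardSmoothOfRelativeDimension
    K n 𝔪
  have hdim𝔪' : ringKrullDim (Localization.AtPrime 𝔪) = n := by rw [hdim𝔪, hcd]
  obtain ⟨t, ht, htspan⟩ := exists_sub_sum_smul_mem_sq K 𝔪 hdim𝔪' ψ hψ
  exact ⟨c, g, h', 𝔪, h𝔪max, ψ, t, hc.symm, hg, hgen, h𝔭𝔪, hh'𝔪, hh₀𝔪, hψ, hindep, ht, htspan⟩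

end Assembly

end GAGADimension

end Literature.AlgebraicGeometry.HodgeTheory
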